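import Summits.SmoothPoincare4.SmoothPoincare4.Theses.WeylBudget
import Summits.SmoothPoincare4.SmoothPoincare4.Theorems.WeylBudgetCorkRegluingBudgetIsometricRegluingTransport
import Summits.SmoothPoincare4.SmoothPoincare4.Theorems.WeylBudgetCorkRegluingBudgetStubB1bConjugateRound
import Summits.SmoothPoincare4.SmoothPoincare4.Theorems.WeylBudgetBudgetTransferPointwise
import HarnessLib

/-!
# Bridge sub-goal BR2 of crux `CorkRegluingBudget` (line `registered`, RESHAPE 3): transport of a
# symmetric Weyl-light PSC metric WITH ITS GERM along the uniqueness of gluings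

Registered sub-goal `bridge_transportGerm` of `stub_warpedBridge` (item stmt-SmoothPoincare4-10831).
If a closed 4-manifold `P`, glued from the pieces `C`, `W` along `φ` (explicit piece embeddings
`kC, kW`), carries a Riemannian metric `γ` with Levi-Civita connection, `scal > 0`,
`weylEnergy < 32π²`, an open `V ⊇ seam` and a map `Ψ` smooth and injective on `V`, `γ`-isometric on
`V`, side-preserving, restricting to `τ` on the seam, then so does the standard `S⁴` presented as the
same gluing (`IsBoundaryGluing bC bW φ (𝓡 4) S⁴`): transport along the diffeomorphism `F : S⁴ ≅ P`
given by the uniqueness of boundary gluings (`nonempty_diffeomorph_of_isBoundaryGluing_holds`), with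
`jC := F⁻¹ ∘ kC`, `g := F^* γ`, `U := F⁻¹(V)`, `Φ := F⁻¹ ∘ Ψ ∘ F`; scalar curvature by
`scalarCurvature_comap`, Weyl energy by `weylEnergy_eq_of_diffeomorph_pullbackBilin_eq` (p157539),
the isometry clause by the chain rule.  Everything here is to be proved; no definitions, no facts.
-/

set_option linter.dupNamespace false

open scoped Manifold ContDiff Topology
open Set Function

noncomputable section

namespace Summit.SmoothPoincare4.SmoothPoincare4.Theorems.CorkRegluingBudget

open Literature.Geometry.Lorentzian Literature.Geometry.Lorentzian.PseudoRiemannianMetric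
  Literature.Geometry.Riemannian Literature.Topology.FourManifolds

/-- **BR2 — transport of a symmetric Weyl-light PSC metric with its germ** (registered sub-goal
`bridge_transportGerm` of `stub_warpedBridge`, crux `CorkRegluingBudget`, line `registered`
RESHAPE 3): see the module docstring. [cite: HirschDT1976, Ch. 8 §2, Thm. 2.1]
[cite: ONeill1983, Ch. 3, Prop. 3.59] -/
theorem bridge_transportGerm :
    ∀ (C : Type) [TopologicalSpace C] [T2Space C] [ChartedSpace (EuclideanHalfSpace 4) C]
      [IsManifold (𝓡∂ 4) ∞ C] [CompactSpace C]
      (bC : Literature.Topology.FourManifolds.BoundaryData (𝓡∂ 4) C (𝓡 3))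
      (W : Type) [TopologicalSpace W] [T2Space W] [ChartedSpace (EuclideanHalfSpace 4) W]
      [IsManifold (𝓡∂ 4) ∞ W] [CompactSpace W]
      (bW : Literature.Topology.FourManifolds.BoundaryData (𝓡∂ 4) W (𝓡 3))
      (φ : bC.carrier ≃ₘ⟮𝓡 3, 𝓡 3⟯ bW.carrier) (τ : bC.carrier ≃ₘ⟮𝓡 3, 𝓡 3⟯ bC.carrier)
      (P : Type) [TopologicalSpace P] [T2Space P] [SecondCountableTopology P]
      [ChartedSpace (EuclideanSpace ℝ (Fin 4)) P] [IsManifold (𝓡 4) ∞ P]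
      (kC : C → P) (kW : W → P)
      (γ : Literature.Geometry.Lorentzian.PseudoRiemannianMetric (𝓡 4) ∞ (EuclideanSpace ℝ (Fin 4))
        (TangentSpace (𝓡 4) : P → Type _))
      (V : Set P) (Ψ : P → P),
      Manifold.IsSmoothEmbedding (𝓡∂ 4) (𝓡 4) ∞ kC →
      Manifold.IsSmoothEmbedding (𝓡∂ 4) (𝓡 4) ∞ kW →
      Set.range kC ∪ Set.range kW = Set.univ →
      (∀ a b, kC a = kW b ↔ ∃ z, a = bC.incl z ∧ b = bW.incl (φ z)) →
      γ.IsRiemannian →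
      (∃ _ : γ.HasLeviCivita, (∀ x, 0 < γ.scalarCurvature x) ∧
          γ.weylEnergy < ENNReal.ofReal (32 * Real.pi ^ 2)) →
      IsOpen V →
      (∀ z, kC (bC.incl z) ∈ V) →
      ContMDiffOn (𝓡 4) (𝓡 4) ∞ Ψ V →
      Set.InjOn Ψ V →
      (∀ x ∈ V, Literature.Geometry.Lorentzian.pullbackBilin (I := 𝓡 4) (I' := 𝓡 4) Ψ γ.val x =
        γ.val x) →
      (∀ x ∈ V, x ∈ Set.range kC → Ψ x ∈ Set.range kC) →
      (∀ x ∈ V, x ∈ Set.range kW → Ψ x ∈ Set.range kW) →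
      (∀ z, Ψ (kC (bC.incl z)) = kC (bC.incl (τ z))) →
      Literature.Topology.FourManifolds.IsBoundaryGluing bC bW φ (𝓡 4)
          (Metric.sphere (0 : EuclideanSpace ℝ (Fin 5)) 1) →
      ∃ (jC : C → Metric.sphere (0 : EuclideanSpace ℝ (Fin 5)) 1)
        (jW : W → Metric.sphere (0 : EuclideanSpace ℝ (Fin 5)) 1)
        (g : Literature.Geometry.Lorentzian.PseudoRiemannianMetric (𝓡 4) ∞ (EuclideanSpace ℝ (Fin 4))
          (TangentSpace (𝓡 4) : Metric.sphere (0 : EuclideanSpace ℝ (Fin 5)) 1 → Type _))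
        (U : Set (Metric.sphere (0 : EuclideanSpace ℝ (Fin 5)) 1))
        (Φ : Metric.sphere (0 : EuclideanSpace ℝ (Fin 5)) 1 →
          Metric.sphere (0 : EuclideanSpace ℝ (Fin 5)) 1),
        Manifold.IsSmoothEmbedding (𝓡∂ 4) (𝓡 4) ∞ jC ∧
          Manifold.IsSmoothEmbedding (𝓡∂ 4) (𝓡 4) ∞ jW ∧
          Set.range jC ∪ Set.range jW = Set.univ ∧
          (∀ a b, jC a = jW b ↔ ∃ z, a = bC.incl z ∧ b = bW.incl (φ z)) ∧
          g.IsRiemannian ∧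
          (∃ _ : g.HasLeviCivita, (∀ x, 0 < g.scalarCurvature x) ∧
              g.weylEnergy < ENNReal.ofReal (32 * Real.pi ^ 2)) ∧
          IsOpen U ∧
          (∀ z, jC (bC.incl z) ∈ U) ∧
          ContMDiffOn (𝓡 4) (𝓡 4) ∞ Φ U ∧
          Set.InjOn Φ U ∧
          (∀ x ∈ U, Literature.Geometry.Lorentzian.pullbackBilin (I := 𝓡 4) (I' := 𝓡 4) Φ g.val x =
            g.val x) ∧
          (∀ x ∈ U, x ∈ Set.range jC → Φ x ∈ Set.range jC) ∧
          (∀ x ∈ U, x ∈ Set.range jW → Φ x ∈ Set.range jW) ∧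
          (∀ z, Φ (jC (bC.incl z)) = jC (bC.incl (τ z))) := by
  intro C _ _ _ _ _ bC W _ _ _ _ _ bW φ τ P _ _ _ _ _ kC kW γ V Ψ hkC hkW hcov hseam hγ hcurv hV hYV
    hΨs hΨi hΨg hΨC hΨW hΨτ hS4
  obtain ⟨hLC, hscal, hweyl⟩ := hcurv
  -- the comparison diffeomorphism `F : P ≅ S⁴` (uniqueness of boundary gluings)
  have hX : IsBoundaryGluing bC bW φ (𝓡 4) P := ⟨kC, kW, hkC, hkW, hcov, hseam⟩
  obtain ⟨F⟩ := nonempty_diffeomorph_of_isBoundaryGluing_holds hX hS4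
  -- the transported metric `g := (F⁻¹)^* γ`
  have hFs : ContMDiff (𝓡 4) (𝓡 4) (((⊤ : ℕ∞) : ℕ∞ω) + 1) F.symm := F.symm.contMDiff
  have hF' : ∀ y, Injective (mfderiv (𝓡 4) (𝓡 4) F.symm y) :=
    injective_mfderiv_diffeomorph_symm F
  set g : PseudoRiemannianMetric (𝓡 4) ∞ (EuclideanSpace ℝ (Fin 4))
      (TangentSpace (𝓡 4) : Metric.sphere (0 : EuclideanSpace ℝ (Fin 5)) 1 → Type _) :=
    γ.comap (contMDiff_pullbackBilin_holds (I := 𝓡 4) (M := P) (I' := 𝓡 4)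
      (N := Metric.sphere (0 : EuclideanSpace ℝ (Fin 5)) 1)) F.symm hFs hF' rfl with hg_def
  haveI : g.HasLeviCivita := g.hasLeviCivita
  have hgval : ∀ y, g.val y = pullbackBilin (I := 𝓡 4) (I' := 𝓡 4) F.symm γ.val y := fun y ↦ by
    rw [hg_def, val_comap]
  -- `g` is Riemannian (the differential of `F⁻¹` is injective)
  have hg : g.IsRiemannian := by
    intro p u hu
    rw [hgval, pullbackBilin_apply]
    exact hγ _ _ fun h ↦ hu (hF' p (by rw [h, map_zero]))
  have hFd : MDifferentiable (𝓡 4) (𝓡 4) F := F.contMDiff.mdifferentiable (by simp)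
  have hFsd : MDifferentiable (𝓡 4) (𝓡 4) F.symm := F.symm.contMDiff.mdifferentiable (by simp)
  refine ⟨F ∘ kC, F ∘ kW, g, F.symm ⁻¹' V, F ∘ Ψ ∘ F.symm, hkC.diffeomorph_comp F,
    hkW.diffeomorph_comp F, ?_, ?_, hg, ⟨‹_›, fun x ↦ ?_, ?_⟩, hV.preimage F.symm.continuous,
    fun z ↦ ?_, ?_, ?_, fun x hx ↦ ?_, ?_, ?_, fun z ↦ ?_⟩
  · -- the transported pieces cover `S⁴`
    rw [range_comp, range_comp, ← image_union, hcov, image_univ]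
    exact range_eq_univ.2 F.surjective
  · -- the seam relation is transported along the bijection `F`
    intro a b
    rw [← hseam a b]
    exact F.injective.eq_iff
  · -- positive scalar curvature, by naturality
    have hsc : g.scalarCurvature x = γ.scalarCurvature (F.symm x) :=
      γ.scalarCurvature_comap _ hFs hF' rfl x
    rw [hsc]
    exact hscal _
  · -- the Weyl energy is that of `γ` (`F⁻¹ : (S⁴, g) → (P, γ)` is an isometry), `< 32π²`
    rw [weylEnergy_eq_of_diffeomorph_pullbackBilin_eq γ g hγ hg F.symm (fun y ↦ (hgval y).symm)]
    exact hweyl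
  · -- the seam lies in `U := F (V)`
    show F.symm (F (kC (bC.incl z))) ∈ V
    rw [F.symm_apply_apply]
    exact hYV z
  · -- `Φ := F ∘ Ψ ∘ F⁻¹` is smooth on `U`
    exact F.contMDiff.comp_contMDiffOn (hΨs.comp F.symm.contMDiff.contMDiffOn fun y hy ↦ hy)
  · -- `Φ` is injective on `U`
    intro x hx y hy hxy
    exact F.symm.injective (hΨi hx hy (F.injective hxy))
  · -- `Φ` is a `g`-isometry on `U`: `Φ^* (F⁻¹)^* γ = (F⁻¹ Φ)^* γ = (Ψ F⁻¹)^* γ = (F⁻¹)^* Ψ^* γ`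
    have hxV : F.symm x ∈ V := hx
    have hΨx : MDifferentiableAt (𝓡 4) (𝓡 4) Ψ (F.symm x) :=
      ((hΨs _ hxV).contMDiffAt (hV.mem_nhds hxV)).mdifferentiableAt (by simp)
    have hΨF : MDifferentiableAt (𝓡 4) (𝓡 4) (Ψ ∘ F.symm) x := hΨx.comp x (hFsd x)
    have hΦx : MDifferentiableAt (𝓡 4) (𝓡 4) (F ∘ Ψ ∘ F.symm) x := (hFd _).comp x hΨF
    have h2 : mfderiv (𝓡 4) (𝓡 4) (Ψ ∘ F.symm) x =
        (mfderiv (𝓡 4) (𝓡 4) Ψ (F.symm x)).comp (mfderiv (𝓡 4) (𝓡 4) F.symm x) :=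
      mfderiv_comp x hΨx (hFsd x)
    have h3 : ((F.symm : _ → P) ∘ (F ∘ Ψ ∘ F.symm)) = Ψ ∘ F.symm :=
      funext fun y ↦ F.symm_apply_apply _
    have hkey : ∀ u : TangentSpace (𝓡 4) x,
        mfderiv (𝓡 4) (𝓡 4) F.symm ((F ∘ Ψ ∘ F.symm) x)
            (mfderiv (𝓡 4) (𝓡 4) (F ∘ Ψ ∘ F.symm) x u) =
          mfderiv (𝓡 4) (𝓡 4) Ψ (F.symm x) (mfderiv (𝓡 4) (𝓡 4) F.symm x u) := fun u ↦ by
      have h := mfderiv_comp x (hFsd ((F ∘ Ψ ∘ F.symm) x)) hΦx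
      rw [h3, h2] at h
      exact (DFunLike.congr_fun h u).symm
    have hpt : F.symm ((F ∘ Ψ ∘ F.symm) x) = Ψ (F.symm x) := F.symm_apply_apply _
    ext v w
    rw [pullbackBilin_apply, hgval, pullbackBilin_apply, hkey v, hkey w, hpt, ← pullbackBilin_apply,
      hΨg _ hxV, hgval, pullbackBilin_apply]
  · -- `Φ` preserves the cork side
    rintro x hx ⟨c, rfl⟩
    have hxV : kC c ∈ V := by simpa using hx
    obtain ⟨c', hc'⟩ := hΨC (kC c) hxV ⟨c, rfl⟩
    exact ⟨c', by simp [hc']⟩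
  · -- `Φ` preserves the exterior side
    rintro x hx ⟨w, rfl⟩
    have hxV : kW w ∈ V := by simpa using hx
    obtain ⟨w', hw'⟩ := hΨW (kW w) hxV ⟨w, rfl⟩
    exact ⟨w', by simp [hw']⟩
  · -- `Φ` restricts to `τ` on the seam
    simp [hΨτ]

end Summit.SmoothPoincare4.SmoothPoincare4.Theorems.CorkRegluingBudget

end
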